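import Summits.QuantumFields.YangMills.Theorems.UnitScaleTiltHalvingEffGaugeStepBlockMean
import Literature.MathematicalPhysics.QuantumFieldTheory.Balaban1983to89.T4TermwiseBCH
import HarnessLib

/-!
# Line H (`BirthV10.stub_halvingStep`, stmt-QuantumFields-19200) — (M2′) (b)-row toolbox, brick (B-al-4)₂:
# ★★ THE EFFECTIVE GAUGE DOWN A TOWER TRACKS ANY APPROXIMATE BLOCK-AVERAGING FAMILY — THE RATIO STEP AND THE k-STEP INDUCTION ON THE PYRAMID

Cell `ym3-torus` (HUMAN RULING D-0037: YM₃ on T³ is ladder rung R3 — NOT d = 4, NOT infinite volume, NOT a mass gap, NOT the Clay problem), width seat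
`ym-ust-20520-w3` gen 9 (★w3-19200 g10 02:59:50Z «B-al-3 DOOR + (B-al-4)∕(N3) → w3-20520 g9»; LEAD-H ★w5-19200 g7 WORD 17; my LOCATE adb4b732 #51 §3 (B-al-4)).
`--supports stmt-QuantumFields-19200 --as helper`; THEOREMS ONLY (0 `def`, 0 `sorry`); count-neutral; nothing here claims B-al, the (b)-row, (M2′), the stub, the crux or the gap.

WHAT.  ✓`HalvingEffGaugeStepBlockMean.norm_effGaugeStep_mul_eml_sub_one_le` ((B-al-4)₁, ✓p692310) says one step of the effective-gauge recursion
`κ′(y) = v(Y^{κ})(y)⁻¹ κ(ŷ) v(Y)(y)` is the centre block average `κ(ŷ)·eml{κ(ŷ)⁻¹κ(x_i)}` up to `1 + O(h·e)`.  THIS FILE turns that into a RATIO statement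
against an arbitrary reference family `A` that block-averages approximately (defect `τ` per step), so that ONE induction serves the flat-tower family (`τ = 0`),
lit's corner-based (79)–(80) `uavg` read on the torus (`τ = O(osc²)`, next brick), or B-al-2's own letters:
* §1 ★ `norm_mul_eml_conjRatio_sub_one_le` («the new centre error is the block MEAN of the old errors»: `‖(1+ε_c)·eml{(1+ε_c)⁻¹(1+ε_i)} − 1‖ ≤ E + 160E²`,
  lit ✓`norm_eml_one_add_sub_sub_mean_le`) and ★★ `norm_ratio_step_le` — PURE ALGEBRA-ANALYSIS, all `U1`: ratio errors `E` at the centre and the block sites,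
  reference oscillation `e`, effective-gauge step defect `r₁` ((B-al-4)₁'s shape), reference step defect `τ` ⇒ `‖g′·a′⁻¹ − 1‖ ≤ E + 160E² + 3300·E·e + 5r₁ + 4τ`:
  NON-EXPANSIVE to first order, fed only by `E²`, `E·e` (✓`norm_eml_mul_sub_mul_le`) and the two step defects.
* §2 ★★ `norm_effGauge_ratio_le_of_pyramid` — THE k-STEP INDUCTION on the torus: `κ` = effective-gauge family down the double-bar tower of `X` (recursion of
  ✓`P1FlatCoreFrameLinTower.dbarIterU_gaugeActT_eq_effGauge` VERBATIM), `A` = ANY family; per-level stair sizes `hh j`, reference oscillations `e j`, reference step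
  defects `τ j` on a PYRAMID `S` (closed under centres and centre-stair ends going down), and any real sequence `E` dominating the §1 recursion ⇒ ratio error `≤ E j`
  at every pyramid site of every level — in particular `‖κ_k(Y)·A_k(Y)⁻¹ − 1‖ ≤ E k` at the top.
CURRENCY (LOCATE §2; ★w3-19200 g10 03:22:20Z B-al-2 SIGNATURE: `Φ = 1`, `hh j` local ∝ `d(L−1)ρ_j + L²q_j`, geometric): every feed is pointwise and geometric in
`j`; the closed form of `E k` is the pure-real lemma of px10 g4's (iii) shape.  HONEST SCOPE: elementary; the rows `hh e τ` are DISPLAYED (suppliers: B-al-2's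
per-level H_j and the next brick); nothing of Prop. 3∕4, Theorem 4, (M2′) or the stub is proved here.

References: T. Bałaban, CMP **98** (1985) 17–51 [Balaban1985Averaging] ((84) p.30, (89) p.31, (97)–(100) p.32, (110) p.34); CMP **109** (1987) 249–301
[Balaban1987RG1] ((0.4)–(0.8) p.253).
-/

set_option autoImplicit false

noncomputable section

open scoped BigOperators
open NormedSpace Metric Set

namespace Summit.QuantumFields.YangMills.Theorems.HalvingEffGaugeTowerRatio

open Literature.MathematicalPhysics.QuantumFieldTheory.Balaban1983to89
open T4Continuum BlockAveraging ExpMeanLog MatrixLog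
open B7TransferAnalyticMean (meanCLM meanCLM_apply norm_meanCLM_apply_le IsAnalyticMean)
open BlockAveragingEMLAnalyticMean (isAnalyticMean_eml norm_eml_add_sub_eml_le eml_one norm_eml_one_add_sub_sub_mean_le)
open B10Eq27TorusAxialLog (holT gaugeActT gaugeActT_apply)
open Summit.QuantumFields.YangMills.Theorems.Prop8Chart (holT_gaugeActT)
open Summit.QuantumFields.YangMills.Theorems.Prop8ChartDoubleBar (vframeU coe_vframeU dbarIterU)
open Summit.QuantumFields.YangMills.Theorems.HalvingEffGaugeStepBlockMean (norm_eml_mul_sub_mul_le norm_effGaugeStep_mul_eml_sub_one_le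
  norm_le_one_add_of_norm_sub_one_le)
open B7Prop1Explicit (U1 mem_U1 norm_inv_sub_one_le norm_units_conj_sub_one_le)  open T4TermwiseBCH (norm_units_conj_le norm_units_inv_conj_le)

/-! ## §1 The ratio step, pure algebra-analysis -/

section RatioStep

variable {ι : Type*} [Fintype ι] [Nonempty ι] {𝔸 : Type*} [NormedRing 𝔸] [NormedAlgebra ℂ 𝔸] [CompleteSpace 𝔸] [NormOneClass 𝔸]

omit [Nonempty ι] in
/-- `‖eml W‖ ≤ 3∕2` on the polydisc `‖W − 1‖ ≤ 1∕6`. [folklore] -/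
theorem norm_eml_le {W : ι → 𝔸} (hW : ‖W - 1‖ ≤ 1 / 6) : ‖eml W‖ ≤ 3 / 2 := by
  have hK : ‖eml W - 1‖ ≤ 1 / 2 := by
    refine (isAnalyticMean_eml (ι := ι) (𝔸 := 𝔸)).norm_sub_one_le W ?_
    rw [mem_ball, dist_eq_norm]; linarith
  calc ‖eml W‖ = ‖(eml W - 1) + 1‖ := by rw [sub_add_cancel]
    _ ≤ ‖eml W - 1‖ + ‖(1 : 𝔸)‖ := norm_add_le _ _
    _ ≤ 1 / 2 + 1 := by rw [norm_one]; exact add_le_add hK le_rfl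
    _ = 3 / 2 := by norm_num

/-- **THE BLOCK MEAN OF THE ERRORS**: `‖(1 + ε_c)·eml{(1 + ε_c)⁻¹(1 + ε_i)} − 1‖ ≤ E + 160·E²` when `‖ε_c‖, ‖ε_i‖ ≤ E ≤ 1∕100` — to first order the
centre block average of the error field is the arithmetic mean of the errors (`(1+ε_c)·mean((1+ε_c)⁻¹(1+ε_i) − 1) = mean ε_i − ε_c`; second order by
lit ✓`norm_eml_one_add_sub_sub_mean_le`). [cite: Balaban1987RG1, (0.8) p.253] -/
theorem norm_mul_eml_conjRatio_sub_one_le (uc : 𝔸ˣ) (huc : uc ∈ U1 𝔸) (P : ι → 𝔸) {E : ℝ} (hE1 : E ≤ 1 / 100)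
    (hc : ‖(uc : 𝔸) - 1‖ ≤ E) (hP : ∀ i, ‖(uc : 𝔸) * P i - 1‖ ≤ E) :
    ‖(uc : 𝔸) * eml P - 1‖ ≤ E + 160 * E ^ 2 := by
  have hE0 : 0 ≤ E := (norm_nonneg _).trans hc
  have hPi : ∀ i, ‖P i - 1‖ ≤ 2 * E := fun i => by
    have h1 : P i - 1 = ((uc⁻¹ : 𝔸ˣ) : 𝔸) * (((uc : 𝔸) * P i - 1) - ((uc : 𝔸) - 1)) := by
      rw [mul_sub, mul_sub, mul_one, ← mul_assoc, Units.inv_mul, one_mul, mul_sub, mul_one, Units.inv_mul]; abel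
    rw [h1]
    calc _ ≤ ‖((uc⁻¹ : 𝔸ˣ) : 𝔸)‖ * ‖((uc : 𝔸) * P i - 1) - ((uc : 𝔸) - 1)‖ := norm_mul_le _ _
      _ ≤ 1 * (‖(uc : 𝔸) * P i - 1‖ + ‖(uc : 𝔸) - 1‖) := mul_le_mul huc.2 (norm_sub_le _ _) (norm_nonneg _) zero_le_one
      _ ≤ 1 * (E + E) := by rw [one_mul, one_mul]; exact add_le_add (hP i) hc
      _ = 2 * E := by ring
  have hPn : ‖P - 1‖ ≤ 2 * E := (pi_norm_le_iff_of_nonneg (by positivity)).2 fun i => by simpa only [Pi.sub_apply, Pi.one_apply] using hPi i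
  have hm₂ : ‖eml P - 1 - meanCLM ι 𝔸 (P - 1)‖ ≤ 36 * ‖P - 1‖ ^ 2 := by
    have h := norm_eml_one_add_sub_sub_mean_le (ι := ι) (𝔸 := 𝔸) (V := P - 1) (hPn.trans (by linarith))
    rwa [add_sub_cancel] at h
  have hmean : (uc : 𝔸) * meanCLM ι 𝔸 (P - 1) = meanCLM ι 𝔸 (fun i => (uc : 𝔸) * P i - 1) - ((uc : 𝔸) - 1) := by
    have h1 : (fun i => (uc : 𝔸) * P i - 1) = (fun i => (uc : 𝔸) * (P - 1) i) + (fun _ => (uc : 𝔸) - 1) := by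
      funext i; simp only [Pi.add_apply, Pi.sub_apply, Pi.one_apply, mul_sub, mul_one]; abel
    have h2 : meanCLM ι 𝔸 (fun i => (uc : 𝔸) * (P - 1) i) = (uc : 𝔸) * meanCLM ι 𝔸 (P - 1) := by
      rw [meanCLM_apply, meanCLM_apply, mul_smul_comm, Finset.mul_sum]
    have h3 : meanCLM ι 𝔸 (fun _ : ι => (uc : 𝔸) - 1) = (uc : 𝔸) - 1 := by
      rw [meanCLM_apply, Finset.sum_const, Finset.card_univ, ← Nat.cast_smul_eq_nsmul ℂ, smul_smul,
        inv_mul_cancel₀ (Nat.cast_ne_zero.mpr Fintype.card_ne_zero), one_smul]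
    rw [h1, map_add, h2, h3]; abel
  have hid : (uc : 𝔸) * eml P - 1 = meanCLM ι 𝔸 (fun i => (uc : 𝔸) * P i - 1) + (uc : 𝔸) * (eml P - 1 - meanCLM ι 𝔸 (P - 1)) := by
    rw [mul_sub, mul_sub, mul_one, hmean]; abel
  rw [hid]
  have hmeanE : ‖meanCLM ι 𝔸 (fun i => (uc : 𝔸) * P i - 1)‖ ≤ E :=
    (norm_meanCLM_apply_le _).trans ((pi_norm_le_iff_of_nonneg hE0).2 hP)
  have huc1 : ‖(uc : 𝔸)‖ ≤ 1 := huc.1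
  calc _ ≤ ‖meanCLM ι 𝔸 (fun i => (uc : 𝔸) * P i - 1)‖ + ‖(uc : 𝔸)‖ * ‖eml P - 1 - meanCLM ι 𝔸 (P - 1)‖ :=
        (norm_add_le _ _).trans (add_le_add le_rfl (norm_mul_le _ _))
    _ ≤ E + 1 * (36 * (2 * E) ^ 2) := by
        gcongr
        exact hm₂.trans (by gcongr)
    _ ≤ E + 160 * E ^ 2 := by nlinarith

omit [NormedAlgebra ℂ 𝔸] [CompleteSpace 𝔸] [NormOneClass 𝔸] in
/-- The ring identity behind the ratio step: with `T₁ = gc·X₁·(Z₀ + r₃)`, `T₂ = X₂·eδ⁻¹·ac⁻¹` and `gc·Z₀·eδ⁻¹·ac⁻¹ = L₀`,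
`T₁T₂ − L₀ = gc·((X₁ − 1)(Z₀ + r₃)X₂ + (Z₀ + r₃)(X₂ − 1) + r₃)·eδ⁻¹·ac⁻¹`. [folklore] -/
theorem ratio_diff_identity (gc aci X₁ X₂ Z₀ r₃ eδi L₀ T₁ T₂ : 𝔸)
    (h1 : T₁ = gc * X₁ * (Z₀ + r₃)) (h2 : T₂ = X₂ * eδi * aci) (h3 : gc * Z₀ * eδi * aci = L₀) :
    T₁ * T₂ - L₀ = gc * ((X₁ - 1) * (Z₀ + r₃) * X₂ + (Z₀ + r₃) * (X₂ - 1) + r₃) * eδi * aci := by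
  rw [h1, h2, ← h3]; noncomm_ring

omit [NormedAlgebra ℂ 𝔸] [CompleteSpace 𝔸] [NormOneClass 𝔸] in
set_option maxHeartbeats 400000 in /-- The norm bound behind the ratio step. [folklore] -/
theorem ratio_diff_norm_le {gc aci X₁ X₂ Z r₃ eδi : 𝔸} {r₁ τ ρ : ℝ} (hgc : ‖gc‖ ≤ 1) (haci : ‖aci‖ ≤ 1)
    (hX₁ : ‖X₁ - 1‖ ≤ r₁) (hX₂ : ‖X₂ - 1‖ ≤ τ) (hX₂b : ‖X₂‖ ≤ 11 / 10) (hZ : ‖Z‖ ≤ 5 / 2) (hr₃ : ‖r₃‖ ≤ ρ)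
    (heδi : ‖eδi‖ ≤ 3 / 2) (hr0 : 0 ≤ r₁) :
    ‖gc * ((X₁ - 1) * Z * X₂ + Z * (X₂ - 1) + r₃) * eδi * aci‖ ≤ 3 / 2 * (11 / 4 * r₁ + 5 / 2 * τ + ρ) := by
  have hτ0 : 0 ≤ τ := (norm_nonneg _).trans hX₂
  have hρ0 : 0 ≤ ρ := (norm_nonneg _).trans hr₃
  have hmid : ‖(X₁ - 1) * Z * X₂ + Z * (X₂ - 1) + r₃‖ ≤ 11 / 4 * r₁ + 5 / 2 * τ + ρ := by
    calc _ ≤ ‖(X₁ - 1) * Z * X₂‖ + ‖Z * (X₂ - 1)‖ + ‖r₃‖ := norm_add₃_le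
      _ ≤ ‖X₁ - 1‖ * ‖Z‖ * ‖X₂‖ + ‖Z‖ * ‖X₂ - 1‖ + ‖r₃‖ :=
          add_le_add (add_le_add norm_mul₃_le (norm_mul_le _ _)) le_rfl
      _ ≤ r₁ * (5 / 2) * (11 / 10) + 5 / 2 * τ + ρ := by gcongr
      _ = 11 / 4 * r₁ + 5 / 2 * τ + ρ := by ring
  have hm0 : 0 ≤ 11 / 4 * r₁ + 5 / 2 * τ + ρ := by positivity
  calc _ ≤ ‖gc‖ * ‖(X₁ - 1) * Z * X₂ + Z * (X₂ - 1) + r₃‖ * ‖eδi‖ * ‖aci‖ := by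
        calc _ ≤ ‖gc * ((X₁ - 1) * Z * X₂ + Z * (X₂ - 1) + r₃) * eδi‖ * ‖aci‖ := norm_mul_le _ _
          _ ≤ ‖gc * ((X₁ - 1) * Z * X₂ + Z * (X₂ - 1) + r₃)‖ * ‖eδi‖ * ‖aci‖ := by gcongr; exact norm_mul_le _ _
          _ ≤ ‖gc‖ * ‖(X₁ - 1) * Z * X₂ + Z * (X₂ - 1) + r₃‖ * ‖eδi‖ * ‖aci‖ := by gcongr; exact norm_mul_le _ _
    _ ≤ 1 * (11 / 4 * r₁ + 5 / 2 * τ + ρ) * (3 / 2) * 1 := by gcongr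
    _ = 3 / 2 * (11 / 4 * r₁ + 5 / 2 * τ + ρ) := by ring

set_option maxHeartbeats 400000 in /-- ★★ **THE RATIO STEP** (pure algebra-analysis; every element `U1`-valued).  Data: centre values `gc ac`, block values `g a : ι → 𝔸ˣ`, next-level values
`g′ a′`; ratio errors `‖gc·ac⁻¹ − 1‖ ≤ E`, `‖g_i·a_i⁻¹ − 1‖ ≤ E`; reference oscillation `‖ac⁻¹a_i − 1‖ ≤ e`; the effective-gauge step in (B-al-4)₁'s shape
`‖gc⁻¹·g′·eml{g_i⁻¹gc} − 1‖ ≤ r₁`; the reference step `‖a′⁻¹·ac·eml{ac⁻¹a_i} − 1‖ ≤ τ`.  Then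
`‖g′·a′⁻¹ − 1‖ ≤ E + 160·E² + 3300·E·e + 5·r₁ + 4·τ` — the ratio error is non-expansive to first order (block mean of the old errors,
`norm_mul_eml_conjRatio_sub_one_le`), fed at second order by `E²`, `E·e` (✓`norm_eml_mul_sub_mul_le`) and by the two step defects.
[cite: Balaban1985Averaging, (84) p.30, (110) p.34; Balaban1987RG1, (0.5)-(0.8) p.253] -/
theorem norm_ratio_step_le (gc ac g' a' : 𝔸ˣ) (g a : ι → 𝔸ˣ)
    (hgc : gc ∈ U1 𝔸) (hac : ac ∈ U1 𝔸) (hg : ∀ i, g i ∈ U1 𝔸) (ha : ∀ i, a i ∈ U1 𝔸)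
    {E e r₁ τ : ℝ} (hE1 : E ≤ 1 / 100) (he0 : 0 ≤ e) (he1 : e ≤ 1 / 100) (hr0 : 0 ≤ r₁) (hτ1 : τ ≤ 1 / 10)
    (hEc : ‖(gc : 𝔸) * ((ac⁻¹ : 𝔸ˣ) : 𝔸) - 1‖ ≤ E) (hEi : ∀ i, ‖(g i : 𝔸) * (((a i)⁻¹ : 𝔸ˣ) : 𝔸) - 1‖ ≤ E)
    (he : ∀ i, ‖((ac⁻¹ : 𝔸ˣ) : 𝔸) * (a i : 𝔸) - 1‖ ≤ e)
    (hstep : ‖((gc⁻¹ : 𝔸ˣ) : 𝔸) * (g' : 𝔸) * eml (fun i => (((g i)⁻¹ * gc : 𝔸ˣ) : 𝔸)) - 1‖ ≤ r₁)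
    (href : ‖((a'⁻¹ : 𝔸ˣ) : 𝔸) * (ac : 𝔸) * eml (fun i => ((ac⁻¹ * a i : 𝔸ˣ) : 𝔸)) - 1‖ ≤ τ) :
    ‖(g' : 𝔸) * ((a'⁻¹ : 𝔸ˣ) : 𝔸) - 1‖ ≤ E + 160 * E ^ 2 + 3300 * E * e + 5 * r₁ + 4 * τ := by
  have hE0 : 0 ≤ E := (norm_nonneg _).trans hEc
  obtain ⟨uc, huc⟩ : ∃ uc : 𝔸ˣ, uc = gc * ac⁻¹ := ⟨_, rfl⟩
  obtain ⟨δa, hδa⟩ : ∃ δa : ι → 𝔸ˣ, δa = fun i => ac⁻¹ * a i := ⟨_, rfl⟩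
  obtain ⟨δg, hδg⟩ : ∃ δg : ι → 𝔸ˣ, δg = fun i => gc⁻¹ * g i := ⟨_, rfl⟩
  obtain ⟨Pu, hPu⟩ : ∃ Pu : ι → 𝔸ˣ, Pu = fun i => uc⁻¹ * (g i * (a i)⁻¹) := ⟨_, rfl⟩
  obtain ⟨Q, hQ⟩ : ∃ Q : ι → 𝔸ˣ, Q = fun i => ac⁻¹ * Pu i * ac := ⟨_, rfl⟩
  have hucU : uc ∈ U1 𝔸 := by rw [huc]; exact (U1 𝔸).mul_mem hgc ((U1 𝔸).inv_mem hac)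
  have hEc' : ‖(uc : 𝔸) - 1‖ ≤ E := by rw [huc, Units.val_mul]; exact hEc
  have hδaU : ∀ i, δa i ∈ U1 𝔸 := fun i => by rw [hδa]; exact (U1 𝔸).mul_mem ((U1 𝔸).inv_mem hac) (ha i)
  have hPuU : ∀ i, Pu i ∈ U1 𝔸 := fun i => by
    rw [hPu]; exact (U1 𝔸).mul_mem ((U1 𝔸).inv_mem hucU) ((U1 𝔸).mul_mem (hg i) ((U1 𝔸).inv_mem (ha i)))
  have hδgQ : ∀ i, δg i = Q i * δa i := fun i => by
    rw [hδg, hQ, hPu, hδa, huc]; dsimp only; group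
  obtain ⟨Pc, hPc⟩ : ∃ Pc : ι → 𝔸, Pc = fun i => (Pu i : 𝔸) := ⟨_, rfl⟩
  obtain ⟨Qc, hQc⟩ : ∃ Qc : ι → 𝔸, Qc = fun i => (Q i : 𝔸) := ⟨_, rfl⟩
  obtain ⟨δac, hδac⟩ : ∃ δac : ι → 𝔸, δac = fun i => (δa i : 𝔸) := ⟨_, rfl⟩
  obtain ⟨δainv, hδainv⟩ : ∃ δainv : ι → 𝔸, δainv = fun i => (((δa i)⁻¹ : 𝔸ˣ) : 𝔸) := ⟨_, rfl⟩
  obtain ⟨δgc, hδgc⟩ : ∃ δgc : ι → 𝔸, δgc = fun i => (δg i : 𝔸) := ⟨_, rfl⟩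
  obtain ⟨δginv, hδginv⟩ : ∃ δginv : ι → 𝔸, δginv = fun i => (((δg i)⁻¹ : 𝔸ˣ) : 𝔸) := ⟨_, rfl⟩
  have hPi : ∀ i, ‖(uc : 𝔸) * Pc i - 1‖ ≤ E := fun i => by
    have h1 : (uc : 𝔸) * Pc i = (g i : 𝔸) * (((a i)⁻¹ : 𝔸ˣ) : 𝔸) := by
      rw [hPc]; dsimp only; rw [hPu]; dsimp only; rw [← Units.val_mul, mul_inv_cancel_left, Units.val_mul]
    rw [h1]; exact hEi i
  have hPci : ∀ i, ‖Pc i - 1‖ ≤ 2 * E := fun i => by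
    have h3 : Pc i - 1 = ((uc⁻¹ : 𝔸ˣ) : 𝔸) * (((uc : 𝔸) * Pc i - 1) - ((uc : 𝔸) - 1)) := by
      rw [mul_sub, mul_sub, ← mul_assoc, Units.inv_mul, one_mul, mul_one, mul_sub, mul_one, Units.inv_mul]; abel
    rw [h3]
    calc _ ≤ ‖((uc⁻¹ : 𝔸ˣ) : 𝔸)‖ * ‖((uc : 𝔸) * Pc i - 1) - ((uc : 𝔸) - 1)‖ := norm_mul_le _ _
      _ ≤ 1 * (‖(uc : 𝔸) * Pc i - 1‖ + ‖(uc : 𝔸) - 1‖) := mul_le_mul hucU.2 (norm_sub_le _ _) (norm_nonneg _) zero_le_one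
      _ ≤ 1 * (E + E) := by rw [one_mul, one_mul]; exact add_le_add (hPi i) hEc'
      _ = 2 * E := by ring
  have hPcn : ‖Pc - 1‖ ≤ 2 * E :=
    (pi_norm_le_iff_of_nonneg (by positivity)).2 fun i => by rw [Pi.sub_apply, Pi.one_apply]; exact hPci i
  have hQi : ∀ i, ‖Qc i - 1‖ ≤ 2 * E := fun i => by
    have h1 : Qc i - 1 = ((ac⁻¹ : 𝔸ˣ) : 𝔸) * (Pc i - 1) * (ac : 𝔸) := by
      rw [mul_sub, sub_mul, mul_one, Units.inv_mul, hQc, hPc]; dsimp only; rw [hQ]; dsimp only; rw [Units.val_mul, Units.val_mul]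
    rw [h1]; exact (norm_units_inv_conj_le hac _).trans (hPci i)
  have hQcn : ‖Qc - 1‖ ≤ 2 * E :=
    (pi_norm_le_iff_of_nonneg (by positivity)).2 fun i => by rw [Pi.sub_apply, Pi.one_apply]; exact hQi i
  have hδai : ∀ i, ‖δac i - 1‖ ≤ e := fun i => by rw [hδac]; dsimp only; rw [hδa]; dsimp only; rw [Units.val_mul]; exact he i
  have hδacn : ‖δac - 1‖ ≤ e :=
    (pi_norm_le_iff_of_nonneg he0).2 fun i => by rw [Pi.sub_apply, Pi.one_apply]; exact hδai i
  have hprodfam : Qc * δac = δgc := by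
    funext i; rw [Pi.mul_apply, hQc, hδac, hδgc]; dsimp only; rw [hδgQ, Units.val_mul]
  have hδgcn : ‖δgc - 1‖ ≤ 1 / 10 := by
    rw [← hprodfam]
    refine (HalvingEffGaugeStepBlockMean.norm_mul_sub_one_le (D := δac) hQcn).trans ?_
    nlinarith [hδacn, hE0, he0, norm_nonneg (δac - 1)]
  have hδgi : ∀ i, ‖δgc i - 1‖ ≤ 1 / 10 := fun i => by
    have := (norm_le_pi_norm (δgc - 1) i).trans hδgcn; rwa [Pi.sub_apply, Pi.one_apply] at this
  have hδa_mulinv : eml δac * eml δainv = 1 := by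
    refine eml_mul_inv (fun i => ?_) (fun i => (hδai i).trans (by linarith))
    rw [hδac, hδainv]; dsimp only; rw [← Units.val_mul, mul_inv_cancel, Units.val_one]
  have hδg_invmul : eml δginv * eml δgc = 1 := by
    refine eml_inv_mul (fun i => ?_) (fun i => (hδgi i).trans (by norm_num))
    rw [hδgc, hδginv]; dsimp only; rw [← Units.val_mul, mul_inv_cancel, Units.val_one]
  have hstep' : ‖((gc⁻¹ : 𝔸ˣ) : 𝔸) * (g' : 𝔸) * eml δginv - 1‖ ≤ r₁ := by
    have hfam : δginv = fun i => (((g i)⁻¹ * gc : 𝔸ˣ) : 𝔸) := by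
      funext i; rw [hδginv]; dsimp only; rw [hδg]; dsimp only; rw [mul_inv_rev, inv_inv]
    rw [hfam]; exact hstep
  have href' : ‖((a'⁻¹ : 𝔸ˣ) : 𝔸) * (ac : 𝔸) * eml δac - 1‖ ≤ τ := by
    have hfam : δac = fun i => ((ac⁻¹ * a i : 𝔸ˣ) : 𝔸) := by funext i; rw [hδac]; dsimp only; rw [hδa]
    rw [hfam]; exact href
  obtain ⟨X1, hX1⟩ : ∃ X1 : 𝔸, X1 = ((gc⁻¹ : 𝔸ˣ) : 𝔸) * (g' : 𝔸) * eml δginv := ⟨_, rfl⟩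
  obtain ⟨X2, hX2⟩ : ∃ X2 : 𝔸, X2 = ((a'⁻¹ : 𝔸ˣ) : 𝔸) * (ac : 𝔸) * eml δac := ⟨_, rfl⟩
  obtain ⟨r₃, hr₃⟩ : ∃ r₃ : 𝔸, r₃ = eml δgc - eml Qc * eml δac := ⟨_, rfl⟩
  have hr₃n : ‖r₃‖ ≤ 1024 * (2 * E) * e := by
    rw [hr₃, ← hprodfam]
    exact (norm_eml_mul_sub_mul_le (hQcn.trans (by linarith)) (hδacn.trans (by linarith))).trans (by gcongr)
  have hemlQ : eml Qc = ((ac⁻¹ : 𝔸ˣ) : 𝔸) * eml Pc * (ac : 𝔸) := by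
    have hfam : Qc = fun i => ((ac⁻¹ : 𝔸ˣ) : 𝔸) * Pc i * (ac : 𝔸) := by
      funext i; rw [hQc, hPc]; dsimp only; rw [hQ]; dsimp only; rw [Units.val_mul, Units.val_mul]
    rw [hfam, eml_conj (Units.inv_mul _) (Units.mul_inv _)]
  obtain ⟨Z₀, hZ₀⟩ : ∃ Z₀ : 𝔸, Z₀ = ((ac⁻¹ : 𝔸ˣ) : 𝔸) * eml Pc * (ac : 𝔸) * eml δac := ⟨_, rfl⟩
  have hemlδg : eml δgc = Z₀ + r₃ := by rw [hZ₀, hr₃, hemlQ]; abel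
  have hg'eq : (g' : 𝔸) = (gc : 𝔸) * X1 * (Z₀ + r₃) := by
    rw [hX1, ← hemlδg]
    calc (g' : 𝔸) = (gc : 𝔸) * (((gc⁻¹ : 𝔸ˣ) : 𝔸) * (g' : 𝔸)) * (eml δginv * eml δgc) := by
          rw [hδg_invmul, mul_one, ← mul_assoc, Units.mul_inv, one_mul]
      _ = (gc : 𝔸) * (((gc⁻¹ : 𝔸ˣ) : 𝔸) * (g' : 𝔸) * eml δginv) * eml δgc := by noncomm_ring
  have ha'eq : ((a'⁻¹ : 𝔸ˣ) : 𝔸) = X2 * eml δainv * ((ac⁻¹ : 𝔸ˣ) : 𝔸) := by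
    rw [hX2]
    calc ((a'⁻¹ : 𝔸ˣ) : 𝔸) = ((a'⁻¹ : 𝔸ˣ) : 𝔸) * ((ac : 𝔸) * ((ac⁻¹ : 𝔸ˣ) : 𝔸)) := by rw [Units.mul_inv, mul_one]
      _ = ((a'⁻¹ : 𝔸ˣ) : 𝔸) * (ac : 𝔸) * (eml δac * eml δainv) * ((ac⁻¹ : 𝔸ˣ) : 𝔸) := by rw [hδa_mulinv]; noncomm_ring
      _ = ((a'⁻¹ : 𝔸ˣ) : 𝔸) * (ac : 𝔸) * eml δac * eml δainv * ((ac⁻¹ : 𝔸ˣ) : 𝔸) := by noncomm_ring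
  have hlead : (gc : 𝔸) * Z₀ * eml δainv * ((ac⁻¹ : 𝔸ˣ) : 𝔸) = (uc : 𝔸) * eml Pc := by
    rw [hZ₀, huc, Units.val_mul]
    calc (gc : 𝔸) * (((ac⁻¹ : 𝔸ˣ) : 𝔸) * eml Pc * (ac : 𝔸) * eml δac) * eml δainv * ((ac⁻¹ : 𝔸ˣ) : 𝔸)
          = (gc : 𝔸) * ((ac⁻¹ : 𝔸ˣ) : 𝔸) * eml Pc * ((ac : 𝔸) * ((eml δac * eml δainv) * ((ac⁻¹ : 𝔸ˣ) : 𝔸))) := by noncomm_ring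
      _ = (gc : 𝔸) * ((ac⁻¹ : 𝔸ˣ) : 𝔸) * eml Pc := by rw [hδa_mulinv, one_mul, Units.mul_inv, mul_one]
  have hdiff := ratio_diff_identity (gc : 𝔸) ((ac⁻¹ : 𝔸ˣ) : 𝔸) X1 X2 Z₀ r₃ (eml δainv) ((uc : 𝔸) * eml Pc) _ _ hg'eq ha'eq hlead
  have hemlPc : ‖eml Pc‖ ≤ 3 / 2 := norm_eml_le (hPcn.trans (by linarith))
  have hemlδac : ‖eml δac‖ ≤ 3 / 2 := norm_eml_le (hδacn.trans (by linarith))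
  have hemlδainv : ‖eml δainv‖ ≤ 3 / 2 := by
    refine norm_eml_le ((pi_norm_le_iff_of_nonneg (by norm_num)).2 fun i => ?_)
    rw [Pi.sub_apply, Pi.one_apply, hδainv]; dsimp only
    have h2 : ‖(δa i : 𝔸) - 1‖ ≤ e := by have := hδai i; rw [hδac] at this; exact this
    exact (norm_inv_sub_one_le (hδaU i)).trans (h2.trans (by linarith))
  have hZ₀n : ‖Z₀‖ ≤ 9 / 4 := by
    rw [hZ₀]
    calc _ ≤ ‖((ac⁻¹ : 𝔸ˣ) : 𝔸) * eml Pc * (ac : 𝔸)‖ * ‖eml δac‖ := norm_mul_le _ _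
      _ ≤ 3 / 2 * (3 / 2) := mul_le_mul ((norm_units_inv_conj_le hac _).trans hemlPc) hemlδac (norm_nonneg _) (by norm_num)
      _ = 9 / 4 := by norm_num
  have hEe : 0 ≤ E * e := mul_nonneg hE0 he0
  have hEe1 : E * e ≤ 1 / 10000 := by nlinarith
  have hZn : ‖Z₀ + r₃‖ ≤ 5 / 2 := by
    have h := add_le_add hZ₀n hr₃n
    have : 1024 * (2 * E) * e = 2048 * (E * e) := by ring
    rw [this] at h
    exact (norm_add_le _ _).trans (h.trans (by linarith))
  have hX1n : ‖X1 - 1‖ ≤ r₁ := by rw [hX1]; exact hstep'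
  have hX2n : ‖X2 - 1‖ ≤ τ := by rw [hX2]; exact href'
  have hX2b : ‖X2‖ ≤ 11 / 10 := by
    calc ‖X2‖ = ‖(X2 - 1) + 1‖ := by rw [sub_add_cancel]
      _ ≤ ‖X2 - 1‖ + ‖(1 : 𝔸)‖ := norm_add_le _ _
      _ ≤ τ + 1 := by rw [norm_one]; exact add_le_add hX2n le_rfl
      _ ≤ 11 / 10 := by linarith
  have hdiffn : ‖(g' : 𝔸) * ((a'⁻¹ : 𝔸ˣ) : 𝔸) - (uc : 𝔸) * eml Pc‖ ≤ 3 / 2 * (11 / 4 * r₁ + 5 / 2 * τ + 1024 * (2 * E) * e) := by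
    rw [hdiff]
    exact ratio_diff_norm_le hgc.1 hac.2 hX1n hX2n hX2b hZn hr₃n hemlδainv hr0
  have hleadn : ‖(uc : 𝔸) * eml Pc - 1‖ ≤ E + 160 * E ^ 2 := norm_mul_eml_conjRatio_sub_one_le uc hucU Pc hE1 hEc' hPi
  have htot : 3 / 2 * (11 / 4 * r₁ + 5 / 2 * τ + 1024 * (2 * E) * e) + (E + 160 * E ^ 2) ≤
      E + 160 * E ^ 2 + 3300 * E * e + 5 * r₁ + 4 * τ := by
    have hτ0 : 0 ≤ τ := (norm_nonneg _).trans hX2n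
    nlinarith
  calc ‖(g' : 𝔸) * ((a'⁻¹ : 𝔸ˣ) : 𝔸) - 1‖
      = ‖((g' : 𝔸) * ((a'⁻¹ : 𝔸ˣ) : 𝔸) - (uc : 𝔸) * eml Pc) + ((uc : 𝔸) * eml Pc - 1)‖ := by rw [sub_add_sub_cancel]
    _ ≤ ‖(g' : 𝔸) * ((a'⁻¹ : 𝔸ˣ) : 𝔸) - (uc : 𝔸) * eml Pc‖ + ‖(uc : 𝔸) * eml Pc - 1‖ := norm_add_le _ _
    _ ≤ _ := add_le_add hdiffn hleadn
    _ ≤ _ := htot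

end RatioStep

/-! ## §2 The k-step induction on the pyramid under a top site -/

section Tower

variable {P : Params} {𝔸 : Type*} [NormedRing 𝔸] [NormedAlgebra ℂ 𝔸] [CompleteSpace 𝔸] [NormOneClass 𝔸]

omit [NormedAlgebra ℂ 𝔸] [CompleteSpace 𝔸] in
/-- The oscillation of the gauge being stepped, from the reference oscillation and the ratio errors:
`‖κ(x_i)⁻¹κ(ŷ) − 1‖ ≤ e + (21∕10)·E` when `κ = (1+ε)·A`, `‖ε‖ ≤ E`, `‖A(ŷ)⁻¹A(x_i) − 1‖ ≤ e` (all `U1`). [folklore] -/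
theorem norm_osc_of_ratio {gc ac gi ai : 𝔸ˣ} (hac : ac ∈ U1 𝔸) (hgi : gi ∈ U1 𝔸) (hai : ai ∈ U1 𝔸) {E e : ℝ}
    (hEc : ‖(gc : 𝔸) * ((ac⁻¹ : 𝔸ˣ) : 𝔸) - 1‖ ≤ E) (hEi : ‖(gi : 𝔸) * ((ai⁻¹ : 𝔸ˣ) : 𝔸) - 1‖ ≤ E)
    (he : ‖((ac⁻¹ : 𝔸ˣ) : 𝔸) * (ai : 𝔸) - 1‖ ≤ e) :
    ‖((gi⁻¹ * gc : 𝔸ˣ) : 𝔸) - 1‖ ≤ e + 21 / 10 * E := by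
  have hE0 : 0 ≤ E := (norm_nonneg _).trans hEc
  obtain ⟨uc, huc⟩ : ∃ uc : 𝔸ˣ, uc = gc * ac⁻¹ := ⟨_, rfl⟩
  obtain ⟨ui, hui⟩ : ∃ ui : 𝔸ˣ, ui = gi * ai⁻¹ := ⟨_, rfl⟩
  have hid : gi⁻¹ * gc = ai⁻¹ * (ui⁻¹ * uc) * ac := by rw [huc, hui]; group
  have huiU : ui ∈ U1 𝔸 := by rw [hui]; exact (U1 𝔸).mul_mem hgi ((U1 𝔸).inv_mem hai)
  have h1 : ‖((ui⁻¹ * uc : 𝔸ˣ) : 𝔸) - 1‖ ≤ 21 / 10 * E := by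
    have h2 : ((ui⁻¹ * uc : 𝔸ˣ) : 𝔸) - 1 = ((ui⁻¹ : 𝔸ˣ) : 𝔸) * (((uc : 𝔸) - 1) - ((ui : 𝔸) - 1)) := by
      rw [Units.val_mul]; simp only [mul_sub, mul_one, Units.inv_mul]; abel
    rw [h2]
    calc _ ≤ ‖((ui⁻¹ : 𝔸ˣ) : 𝔸)‖ * ‖((uc : 𝔸) - 1) - ((ui : 𝔸) - 1)‖ := norm_mul_le _ _
      _ ≤ 1 * (‖(uc : 𝔸) - 1‖ + ‖(ui : 𝔸) - 1‖) := mul_le_mul huiU.2 (norm_sub_le _ _) (norm_nonneg _) zero_le_one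
      _ ≤ 1 * (E + E) := by
          rw [one_mul, one_mul]
          exact add_le_add (by rw [huc, Units.val_mul]; exact hEc) (by rw [hui, Units.val_mul]; exact hEi)
      _ ≤ 21 / 10 * E := by linarith
  have h3 : ((gi⁻¹ * gc : 𝔸ˣ) : 𝔸) - 1 =
      ((ai⁻¹ : 𝔸ˣ) : 𝔸) * (((ui⁻¹ * uc : 𝔸ˣ) : 𝔸) - 1) * (ac : 𝔸) + (((ai⁻¹ : 𝔸ˣ) : 𝔸) * (ac : 𝔸) - 1) := by
    rw [hid, Units.val_mul, Units.val_mul]; noncomm_ring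
  rw [h3]
  have h4 : ‖((ai⁻¹ : 𝔸ˣ) : 𝔸) * (ac : 𝔸) - 1‖ ≤ e := by
    have h5 := norm_inv_sub_one_le ((U1 𝔸).mul_mem ((U1 𝔸).inv_mem hac) hai)
    rw [mul_inv_rev, inv_inv, Units.val_mul, Units.val_mul] at h5
    exact h5.trans he
  calc _ ≤ ‖((ai⁻¹ : 𝔸ˣ) : 𝔸) * (((ui⁻¹ * uc : 𝔸ˣ) : 𝔸) - 1) * (ac : 𝔸)‖ + ‖((ai⁻¹ : 𝔸ˣ) : 𝔸) * (ac : 𝔸) - 1‖ := norm_add_le _ _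
    _ ≤ ‖((ai⁻¹ : 𝔸ˣ) : 𝔸)‖ * ‖((ui⁻¹ * uc : 𝔸ˣ) : 𝔸) - 1‖ * ‖(ac : 𝔸)‖ + e := add_le_add norm_mul₃_le h4
    _ ≤ 1 * (21 / 10 * E) * 1 + e := by gcongr; exacts [hai.2, hac.1]
    _ = e + 21 / 10 * E := by ring

/-- ★★ **THE k-STEP INDUCTION ON THE PYRAMID.**  `κ` = the effective-gauge family of a fine gauge down the double-bar tower of `X` (recursion `hκs` =
✓`P1FlatCoreFrameLinTower.dbarIterU_gaugeActT_eq_effGauge`'s `hs` VERBATIM), `A` = ANY reference family; `S j ⊂ T^{(j)}` a pyramid (closed under centres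
and centre-stair ends going down); on it: stair transporters of `U̿^{(j)}X` within `hh j` of `1`, reference oscillation `e j`, reference step defect `τ j`,
initial ratio error `E 0`; `E` any real sequence dominating the ratio-step recursion of §1 level by level.  Then the ratio error at every pyramid site of
every level `j ≤ k` is at most `E j` — in particular `‖κ_k(Y)·A_k(Y)⁻¹ − 1‖ ≤ E k` at the top.
[cite: Balaban1985Averaging, (97)-(100) p.32, (110) p.34; Balaban1987RG1, (0.5)-(0.8) p.253] -/
theorem norm_effGauge_ratio_le_of_pyramid (X : GaugeField P 0 𝔸ˣ)
    (κ A : (j : ℕ) → GaugeTransf P j 𝔸ˣ)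
    (hκs : ∀ (j : ℕ) (y : Site P (j + 1)),
      κ (j + 1) y = (vframeU (gaugeActT (κ j) (dbarIterU j X)) y)⁻¹ * κ j (emb y) * vframeU (dbarIterU j X) y)
    (hκU : ∀ j x, κ j x ∈ U1 𝔸) (hAU : ∀ j x, A j x ∈ U1 𝔸)
    (hHU : ∀ (j : ℕ) (y : Site P (j + 1)) (i : Idx P), holT (dbarIterU j X) (emb y) (stairWord i.2.1 (off i.1)) ∈ U1 𝔸)
    {k : ℕ} (S : (j : ℕ) → Set (Site P j))
    (hS : ∀ j, j < k → ∀ y ∈ S (j + 1), emb y ∈ S j ∧ ∀ i : Idx P, walkEnd (emb y) (stairWord i.2.1 (off i.1)) ∈ S j)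
    (hh e τ E : ℕ → ℝ)
    (hh0 : ∀ j, 0 ≤ hh j) (hh1 : ∀ j, hh j ≤ 1 / 64) (he0 : ∀ j, 0 ≤ e j) (he1 : ∀ j, e j ≤ 1 / 200) (hτ1 : ∀ j, τ j ≤ 1 / 10)
    (hE1 : ∀ j, j ≤ k → E j ≤ 1 / 200)
    (hH : ∀ j, j < k → ∀ y ∈ S (j + 1), ∀ i : Idx P,
      ‖((holT (dbarIterU j X) (emb y) (stairWord i.2.1 (off i.1)) : 𝔸ˣ) : 𝔸) - 1‖ ≤ hh j)
    (hosc : ∀ j, j < k → ∀ y ∈ S (j + 1), ∀ i : Idx P,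
      ‖(((A j (emb y))⁻¹ * A j (walkEnd (emb y) (stairWord i.2.1 (off i.1))) : 𝔸ˣ) : 𝔸) - 1‖ ≤ e j)
    (href : ∀ j, j < k → ∀ y ∈ S (j + 1),
      ‖(((A (j + 1) y)⁻¹ * A j (emb y) : 𝔸ˣ) : 𝔸) *
          eml (fun i : Idx P => (((A j (emb y))⁻¹ * A j (walkEnd (emb y) (stairWord i.2.1 (off i.1))) : 𝔸ˣ) : 𝔸)) - 1‖ ≤ τ j)
    (hinit : ∀ x ∈ S 0, ‖((κ 0 x : 𝔸ˣ) : 𝔸) * (((A 0 x)⁻¹ : 𝔸ˣ) : 𝔸) - 1‖ ≤ E 0)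
    (hE : ∀ j, j < k →
      E j + 160 * E j ^ 2 + 3300 * E j * e j + 5 * (1536 * hh j * (e j + 21 / 10 * E j)) + 4 * τ j ≤ E (j + 1)) :
    ∀ j, j ≤ k → ∀ x ∈ S j, ‖((κ j x : 𝔸ˣ) : 𝔸) * (((A j x)⁻¹ : 𝔸ˣ) : 𝔸) - 1‖ ≤ E j := by
  intro j
  induction j with
  | zero => intro _ x hx; exact hinit x hx
  | succ j ih =>
    intro hjk y hy
    have hj : j < k := Nat.lt_of_succ_le hjk
    have ihj := ih hj.le
    obtain ⟨hemb, hends⟩ := hS j hj y hy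
    have hEj0 : 0 ≤ E j := (norm_nonneg _).trans (ihj _ hemb)
    have hEj1 : E j ≤ 1 / 100 := (hE1 j hj.le).trans (by norm_num)
    have hoscκ : ∀ i : Idx P,
        ‖((((κ j (walkEnd (emb y) (stairWord i.2.1 (off i.1))))⁻¹ * κ j (emb y)) : 𝔸ˣ) : 𝔸) - 1‖ ≤ e j + 21 / 10 * E j :=
      fun i => norm_osc_of_ratio (hAU j _) (hκU j _) (hAU j _) (ihj _ hemb) (ihj _ (hends i))
        (by have h := hosc j hj y hy i; rwa [Units.val_mul] at h)
    have hr₁ := norm_effGaugeStep_mul_eml_sub_one_le (κ j) (dbarIterU j X) y (hκU j) (hHU j y)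
      (hh0 j) (by have := he0 j; positivity) (hH j hj y hy) hoscκ (hh1 j) (by have := he1 j; have := hE1 j hj.le; linarith)
    rw [← hκs j y, Units.val_mul] at hr₁
    have hstep := norm_ratio_step_le (ι := Idx P) (κ j (emb y)) (A j (emb y)) (κ (j + 1) y) (A (j + 1) y)
      (fun i => κ j (walkEnd (emb y) (stairWord i.2.1 (off i.1)))) (fun i => A j (walkEnd (emb y) (stairWord i.2.1 (off i.1))))
      (hκU j _) (hAU j _) (fun i => hκU j _) (fun i => hAU j _) hEj1 (he0 j) ((he1 j).trans (by norm_num))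
      (by have := hh0 j; have := he0 j; positivity) (hτ1 j)
      (ihj _ hemb) (fun i => ihj _ (hends i)) (fun i => by have h := hosc j hj y hy i; rwa [Units.val_mul] at h) hr₁
      (by have h := href j hj y hy; rwa [Units.val_mul] at h)
    exact hstep.trans (hE j hj)

end Tower

end Summit.QuantumFields.YangMills.Theorems.HalvingEffGaugeTowerRatio

end
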